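import Mathlib.RingTheory.MvPolynomial.Homogeneous
import Mathlib.RingTheory.GradedAlgebra.Homogeneous.Ideal
import Mathlib.AlgebraicGeometry.ProjectiveSpectrum.Scheme
import Mathlib.RingTheory.Ideal.Maps
import Literature.AlgebraicGeometry.Resolution.WeightedCentreHasseSubspace
import HarnessLib

/-!
# [OURS · L1 W4.5(b) · EL♮(3) · WIDTH TABLE D5 «IMMATURE HOST», supplier row HOPEN, input (IN-1) joint birth, bricks (B2a)/(B2b)] THE KEY FORM'S θ-LIFT
# `KeyForm.asHomogeneousIdeal_toIdeal_eq_span` (B2a) · `KeyForm.exists_keyForm_lift` (B2b) — SIG `L/res-L1-w45b-stub-4/KeyFormSIG.lean` 6e4862d4abec49c6 VERBATIM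

res-L1-w45b-stub-4 g12 (desk R59: (IN-1) split; bricks (B0)/(B2a)/(B2b)/(B5)/(B7) = stub-4).  OURS; NOT a statement of any manuscript ([Hironaka2017] is a candidate
under adjudication, nothing of it is asserted); AI-written, weaker than expert review.  No `sorry`; standard axioms; DEF-FREE; pure polynomial algebra.
`--supports stmt-ResolutionOfSingularities-20148 --as helper`.

* (B2a) `asHomogeneousIdeal_toIdeal_eq_span` — for a point `x₀ ∈ ℙⁿ_k` with a zero-locus dictionary in coordinates `ā` normalised by `ā i₀ = 1` (✓
  `exists_coords_of_isClosed`, ✓ `coords_dictionary_smul`; for (IN-1): the section's reduced coordinates, brick (B0)): `𝔭_{x₀} = (x_j − ā_j·x_{i₀})_j`.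
  Key steps `sub_aeval_mem_span`: `P − P(ā·x_{i₀}) ∈ (x_j − ā_j x_{i₀})` for EVERY polynomial `P` (two algebra maps to the quotient agree on the variables), and
  `aeval_smul_X_of_isHomogeneous`: `P(ā·x_{i₀}) = P(ā)·x_{i₀}^m` for `P` homogeneous of degree `m` (Literature `eval_smul_of_isHomogeneous` over `k[x]`).
* (B2b) `exists_keyForm_lift` — along a surjection `θ : O ↠ k` (so `map θ : O[x] ↠ k[x]`), the key form `G = ℓh^α U + ℓh R₁ + R₂ ℓj` with
  `Rᵢ ∈ 𝔭̄^α`, `𝔭̄ = (x_j − θ(a_j) x_{i₀})`, lifts along given lifts `Lh, Lj` of `ℓh, ℓj` to `Gt ∈ O[x]_e` with `map θ Gt = G` and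
  `Gt ∈ (Lh^α) + (Lh)·𝔓^α + 𝔓^α·(Lj)`, `𝔓 = (x_j − a_j x_{i₀})`: pull `Rᵢ` back through `map θ (𝔓^α) = 𝔭̄^α` (`Ideal.mem_map_iff_of_surjective`), take ANY
  lifts, and replace the sum by its degree-`e` homogeneous component — the gauge ideal is homogeneous (`Ideal.homogeneous_span`, `.mul`, `.sup`), so the
  component stays in it (`MvPolynomial.homogeneousComponent_mem_of_mem`), and homogeneous components commute with `map θ` (`homogeneousComponent_map`).
[folklore; elementary polynomial algebra]
-/

set_option linter.dupNamespace false

noncomputable section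

open MvPolynomial AlgebraicGeometry

namespace Summit.ResolutionOfSingularities.ResolutionOfSingularities.Cruxes.EquisingularLiftNat.Sections

namespace KeyForm

/-! ## Polynomial lemmas -/

section Poly

variable {R : Type*} [CommRing R] {n : ℕ}

/-- `P − P(x_j ↦ c_j · x_{i₀}) ∈ (x_j − c_j x_{i₀})_j` for every polynomial `P`: the quotient map and its composite with the substitution agree on the
variables. [folklore] -/
theorem sub_aeval_mem_span (c : Fin (n + 1) → R) (i₀ : Fin (n + 1)) (P : MvPolynomial (Fin (n + 1)) R) :
    P - aeval (fun j => C (c j) * X i₀) P ∈ Ideal.span (Set.range fun j : Fin (n + 1) => X j - C (c j) * X i₀) := by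
  set I : Ideal (MvPolynomial (Fin (n + 1)) R) := Ideal.span (Set.range fun j : Fin (n + 1) => X j - C (c j) * X i₀) with hI
  rw [← Ideal.Quotient.eq]
  have h : (Ideal.Quotient.mkₐ R I).comp (AlgHom.id R _) = (Ideal.Quotient.mkₐ R I).comp (aeval fun j => C (c j) * X i₀) := by
    refine MvPolynomial.algHom_ext fun j => ?_
    simp only [AlgHom.comp_apply, AlgHom.id_apply, aeval_X, Ideal.Quotient.mkₐ_eq_mk]
    rw [Ideal.Quotient.eq]
    exact Ideal.subset_span ⟨j, rfl⟩
  have h2 := congrArg (fun f => f P) h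
  simpa only [AlgHom.comp_apply, AlgHom.id_apply, Ideal.Quotient.mkₐ_eq_mk] using h2

/-- For `P` homogeneous of degree `m`: `P(c_0 x_{i₀}, …, c_n x_{i₀}) = P(c) · x_{i₀}^m`. [folklore] -/
theorem aeval_smul_X_of_isHomogeneous (c : Fin (n + 1) → R) (i₀ : Fin (n + 1)) {P : MvPolynomial (Fin (n + 1)) R} {m : ℕ}
    (hP : P.IsHomogeneous m) : aeval (fun j => C (c j) * X i₀) P = C (eval c P) * X i₀ ^ m := by
  -- pass to coefficients in `R[x]`: `aeval f P = eval f (map C P)`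
  have h1 : aeval (fun j => C (c j) * X i₀) P = eval ((X i₀ : MvPolynomial (Fin (n + 1)) R) • fun j => C (c j)) (map C P) := by
    rw [eval_map]
    have hf : ((X i₀ : MvPolynomial (Fin (n + 1)) R) • fun j => C (c j)) = fun j => C (c j) * X i₀ := by
      funext j; simp [mul_comm]
    rw [hf, aeval_def]
    rfl
  have h2 : eval (fun j => (C (c j) : MvPolynomial (Fin (n + 1)) R)) (map (C : R →+* MvPolynomial (Fin (n + 1)) R) P) = C (eval c P) := by
    rw [eval_map, show eval c P = eval₂ (RingHom.id R) c P from rfl, eval₂_comp_left C (RingHom.id R) c P, RingHom.comp_id]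
    rfl
  rw [h1, Literature.AlgebraicGeometry.Resolution.WeightedBlowup.HasseDir.eval_smul_of_isHomogeneous (hP.map C), h2, mul_comm]

/-- A homogeneous polynomial of positive degree vanishing at `c` (with `c i₀ = 1` irrelevant here) lies in `(x_j − c_j x_{i₀})_j`. [folklore] -/
theorem mem_span_of_isHomogeneous_of_eval_eq_zero (c : Fin (n + 1) → R) (i₀ : Fin (n + 1)) {P : MvPolynomial (Fin (n + 1)) R} {m : ℕ}
    (hP : P.IsHomogeneous m) (h0 : eval c P = 0) :
    P ∈ Ideal.span (Set.range fun j : Fin (n + 1) => X j - C (c j) * X i₀) := by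
  have h := sub_aeval_mem_span c i₀ P
  rwa [aeval_smul_X_of_isHomogeneous c i₀ hP, h0, C_0, zero_mul, sub_zero] at h

/-- Conversely every element of `(x_j − c_j x_{i₀})_j` vanishes at `c` when `c i₀ = 1`. [folklore] -/
theorem eval_eq_zero_of_mem_span (c : Fin (n + 1) → R) (i₀ : Fin (n + 1)) (hc : c i₀ = 1) {P : MvPolynomial (Fin (n + 1)) R}
    (hP : P ∈ Ideal.span (Set.range fun j : Fin (n + 1) => X j - C (c j) * X i₀)) : eval c P = 0 := by
  rw [← RingHom.mem_ker]
  refine (Ideal.span_le.mpr ?_) hP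
  rintro _ ⟨j, rfl⟩
  rw [SetLike.mem_coe, RingHom.mem_ker]
  simp [hc]

/-- Homogeneous components commute with coefficient maps. [folklore] -/
theorem homogeneousComponent_map {S : Type*} [CommRing S] {σ : Type*} (f : R →+* S) (m : ℕ) (P : MvPolynomial σ R) :
    homogeneousComponent m (map f P) = map f (homogeneousComponent m P) := by
  classical
  ext d
  simp only [coeff_homogeneousComponent, coeff_map]
  split_ifs <;> simp

end Poly

/-! ## (B2a) the homogeneous ideal of a point with normalised coordinates -/

/-- **(B2a)** For a point `x₀ ∈ ℙⁿ_k` with the zero-locus dictionary in coordinates `ā` (`ā i₀ = 1`): `𝔭_{x₀} = (x_j − ā_j x_{i₀})_j` as ideals of `k[x]`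
(SIG 6e4862d4abec49c6 verbatim).  `⊇`: the generators are linear forms vanishing at `ā`; `⊆`: a homogeneous ideal is generated by the homogeneous components
of its members — those of positive degree vanish at `ā` (dictionary) and lie in the span (`mem_span_of_isHomogeneous_of_eval_eq_zero`), the constant one is `0`
because `𝔭_{x₀}` is proper. [cite: Hartshorne1977, II Prop. 2.5] [OURS · L1 W4.5b · (IN-1) brick (B2a)] -/
theorem asHomogeneousIdeal_toIdeal_eq_span {k : Type} [Field k] {n : ℕ} :
    letI := MvPolynomial.gradedAlgebra (σ := Fin (n + 1)) (R := k)
    ∀ (x₀ : Proj (homogeneousSubmodule (Fin (n + 1)) k)) (ab : Fin (n + 1) → k) (i₀ : Fin (n + 1)), ab i₀ = 1 →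
    (∀ (m : ℕ), 0 < m → ∀ (G : MvPolynomial (Fin (n + 1)) k), G ∈ homogeneousSubmodule (Fin (n + 1)) k m →
      (G ∈ x₀.asHomogeneousIdeal ↔ MvPolynomial.eval ab G = 0)) →
    x₀.asHomogeneousIdeal.toIdeal = Ideal.span (Set.range fun j : Fin (n + 1) => X j - C (ab j) * X i₀) := by
  intro x₀ ab i₀ hab hD
  classical
  letI := MvPolynomial.gradedAlgebra (σ := Fin (n + 1)) (R := k)
  apply le_antisymm
  · intro F hF
    rw [← sum_homogeneousComponent F]
    refine Ideal.sum_mem _ fun m _ => ?_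
    have hm : homogeneousComponent m F ∈ x₀.asHomogeneousIdeal.toIdeal :=
      homogeneousComponent_mem_of_mem x₀.asHomogeneousIdeal.isHomogeneous hF m
    rcases Nat.eq_zero_or_pos m with rfl | hmpos
    · -- the constant component of a member of the proper ideal `𝔭_{x₀}` vanishes
      rw [homogeneousComponent_zero] at hm ⊢
      by_cases hc : coeff 0 F = 0
      · rw [hc, C_0]; exact Ideal.zero_mem _
      · exfalso
        exact x₀.isPrime.ne_top (Ideal.eq_top_of_isUnit_mem _ hm ((IsUnit.mk0 _ hc).map C))
    · exact mem_span_of_isHomogeneous_of_eval_eq_zero ab i₀ (homogeneousComponent_isHomogeneous m F)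
        ((hD m hmpos _ (homogeneousComponent_mem m F)).mp hm)
  · rw [Ideal.span_le]
    rintro _ ⟨j, rfl⟩
    have h1 : (X j - C (ab j) * X i₀ : MvPolynomial (Fin (n + 1)) k) ∈ homogeneousSubmodule (Fin (n + 1)) k 1 :=
      (isHomogeneous_X k j).sub (isHomogeneous_C_mul_X (ab j) i₀)
    have h2 : (X j - C (ab j) * X i₀ : MvPolynomial (Fin (n + 1)) k) ∈ x₀.asHomogeneousIdeal :=
      (hD 1 one_pos _ h1).mpr (by simp [hab])
    exact h2

/-! ## (B2b) the θ-lift of the key form in the homogeneous gauge ideal -/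

/-- **(B2b)** Along a surjection `θ : O ↠ k`: the key form `G = ℓh^α U + ℓh R₁ + R₂ ℓj` (`ℓh = map θ Lh`, `ℓj = map θ Lj`, `Rᵢ ∈ 𝔭̄^α`,
`𝔭̄ = (x_j − θ(a_j) x_{i₀})_j`) lifts to `Gt ∈ O[x]` homogeneous of degree `e` with `map θ Gt = G` and `Gt ∈ (Lh^α) + (Lh)·𝔓^α + 𝔓^α·(Lj)`,
`𝔓 = (x_j − a_j x_{i₀})_j` (SIG 6e4862d4abec49c6 verbatim).  See the module docstring. [folklore] [OURS · L1 W4.5b · (IN-1) brick (B2b)] -/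
theorem exists_keyForm_lift {O k : Type} [CommRing O] [Field k] (θ : O →+* k) (hθ : Function.Surjective θ) {n : ℕ}
    (a : Fin (n + 1) → O) (i₀ : Fin (n + 1))
    (Lh Lj : MvPolynomial (Fin (n + 1)) O) (hLh : Lh.IsHomogeneous 1) (hLj : Lj.IsHomogeneous 1)
    (G U R₁ R₂ : MvPolynomial (Fin (n + 1)) k) (e α : ℕ) (hG : G.IsHomogeneous e)
    (hGeq : G = MvPolynomial.map θ Lh ^ α * U + MvPolynomial.map θ Lh * R₁ + R₂ * MvPolynomial.map θ Lj)
    (hR₁ : R₁ ∈ Ideal.span (Set.range fun j : Fin (n + 1) => X j - C (θ (a j)) * X i₀) ^ α)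
    (hR₂ : R₂ ∈ Ideal.span (Set.range fun j : Fin (n + 1) => X j - C (θ (a j)) * X i₀) ^ α) :
    ∃ Gt : MvPolynomial (Fin (n + 1)) O, Gt.IsHomogeneous e ∧ MvPolynomial.map θ Gt = G ∧
      Gt ∈ Ideal.span {Lh ^ α} ⊔ Ideal.span {Lh} * Ideal.span (Set.range fun j : Fin (n + 1) => X j - C (a j) * X i₀) ^ α ⊔
        Ideal.span (Set.range fun j : Fin (n + 1) => X j - C (a j) * X i₀) ^ α * Ideal.span {Lj} := by
  classical
  set 𝔓 : Ideal (MvPolynomial (Fin (n + 1)) O) := Ideal.span (Set.range fun j : Fin (n + 1) => X j - C (a j) * X i₀) with h𝔓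
  have hsurj : Function.Surjective (MvPolynomial.map (σ := Fin (n + 1)) θ) := map_surjective θ hθ
  -- `map θ (𝔓^α) = 𝔭̄^α`
  have hmapP : 𝔓.map (MvPolynomial.map θ) = Ideal.span (Set.range fun j : Fin (n + 1) => X j - C (θ (a j)) * X i₀) := by
    have hf : (⇑(MvPolynomial.map (σ := Fin (n + 1)) θ) ∘ fun j : Fin (n + 1) => X j - C (a j) * X i₀) =
        fun j : Fin (n + 1) => X j - C (θ (a j)) * X i₀ := by
      funext j
      rw [Function.comp_apply, map_sub, map_mul, map_X, map_C, map_X]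
    rw [h𝔓, Ideal.map_span, ← Set.range_comp, hf]
  have hmapPa : (𝔓 ^ α).map (MvPolynomial.map θ) = Ideal.span (Set.range fun j : Fin (n + 1) => X j - C (θ (a j)) * X i₀) ^ α := by
    rw [Ideal.map_pow, hmapP]
  -- lifts of `R₁, R₂` INSIDE `𝔓^α`, and of `U`
  rw [← hmapPa] at hR₁ hR₂
  obtain ⟨Rt₁, hRt₁, hRt₁eq⟩ := (Ideal.mem_map_iff_of_surjective _ hsurj).mp hR₁
  obtain ⟨Rt₂, hRt₂, hRt₂eq⟩ := (Ideal.mem_map_iff_of_surjective _ hsurj).mp hR₂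
  obtain ⟨Ut, hUt⟩ := hsurj U
  set Pt : MvPolynomial (Fin (n + 1)) O := Lh ^ α * Ut + Lh * Rt₁ + Rt₂ * Lj with hPt
  have hPtG : MvPolynomial.map θ Pt = G := by
    rw [hPt, hGeq, map_add, map_add, map_mul, map_mul, map_mul, map_pow, hUt, hRt₁eq, hRt₂eq]
  -- the gauge ideal is homogeneous
  set J : Ideal (MvPolynomial (Fin (n + 1)) O) := Ideal.span {Lh ^ α} ⊔ Ideal.span {Lh} * 𝔓 ^ α ⊔ 𝔓 ^ α * Ideal.span {Lj} with hJ
  have hPtJ : Pt ∈ J := by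
    refine Ideal.add_mem _ (Ideal.add_mem _ ?_ ?_) ?_
    · exact Ideal.mem_sup_left (Ideal.mem_sup_left (Ideal.mul_mem_right _ _ (Ideal.mem_span_singleton_self _)))
    · exact Ideal.mem_sup_left (Ideal.mem_sup_right (Ideal.mul_mem_mul (Ideal.mem_span_singleton_self _) hRt₁))
    · exact Ideal.mem_sup_right (Ideal.mul_mem_mul hRt₂ (Ideal.mem_span_singleton_self _))
  letI := MvPolynomial.gradedAlgebra (σ := Fin (n + 1)) (R := O)
  have hJhom : J.IsHomogeneous (homogeneousSubmodule (Fin (n + 1)) O) := by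
    have hP : 𝔓.IsHomogeneous (homogeneousSubmodule (Fin (n + 1)) O) := by
      refine Ideal.homogeneous_span _ _ ?_
      rintro _ ⟨j, rfl⟩
      exact ⟨1, (isHomogeneous_X O j).sub (isHomogeneous_C_mul_X (a j) i₀)⟩
    have hPa : ∀ m : ℕ, (𝔓 ^ m).IsHomogeneous (homogeneousSubmodule (Fin (n + 1)) O) := fun m => by
      induction m with
      | zero => rw [pow_zero, Ideal.one_eq_top]; exact (⊤ : HomogeneousIdeal (homogeneousSubmodule (Fin (n + 1)) O)).isHomogeneous
      | succ m ih => rw [pow_succ]; exact ih.mul hP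
    have h1 : (Ideal.span {Lh ^ α}).IsHomogeneous (homogeneousSubmodule (Fin (n + 1)) O) :=
      Ideal.homogeneous_span _ _ (fun x hx => by rw [Set.mem_singleton_iff] at hx; subst hx; exact ⟨α, by simpa using hLh.pow α⟩)
    have h2 : (Ideal.span {Lh}).IsHomogeneous (homogeneousSubmodule (Fin (n + 1)) O) :=
      Ideal.homogeneous_span _ _ (fun x hx => by rw [Set.mem_singleton_iff] at hx; subst hx; exact ⟨1, hLh⟩)
    have h3 : (Ideal.span {Lj}).IsHomogeneous (homogeneousSubmodule (Fin (n + 1)) O) :=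
      Ideal.homogeneous_span _ _ (fun x hx => by rw [Set.mem_singleton_iff] at hx; subst hx; exact ⟨1, hLj⟩)
    exact (h1.sup (h2.mul (hPa α))).sup ((hPa α).mul h3)
  refine ⟨homogeneousComponent e Pt, homogeneousComponent_isHomogeneous e Pt, ?_, homogeneousComponent_mem_of_mem hJhom hPtJ e⟩
  rw [← homogeneousComponent_map, hPtG, homogeneousComponent_of_mem hG, if_pos rfl]

end KeyForm

end Summit.ResolutionOfSingularities.ResolutionOfSingularities.Cruxes.EquisingularLiftNat.Sections

end
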